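import Literature.NumberTheory.EllipticCurves.Kobayashi2003.SignedSelmerDualExistsProofs
import Literature.NumberTheory.EllipticCurves.IwasawaCoinvariantsRankProofs
import Literature.NumberTheory.EllipticCurves.KatoRankBoundProofs
import Literature.NumberTheory.EllipticCurves.SelmerCorankProofs
import Mathlib.Algebra.Module.CharacterModule
import Mathlib.LinearAlgebra.Dimension.Torsion.Finite
import HarnessLib

/-!
# `rank E(K) ≤ rank_{ℤ_p} X^ε(E/K_∞)/T X^ε(E/K_∞)` and `T^{rank E(K)} ∣ ξ^ε` for Kobayashi's signed
# Selmer groups (proofs; no named fact)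

Topic `Literature/NumberTheory/EllipticCurves`, cluster `Kobayashi2003`; sibling PROOF file of
`SignedSelmer.lean` (p207367: Kobayashi's Def. 1.1 — `E^ε(K_n·K_v)`, `Sel^ε(E/K_n)`, `Sel^ε(E/K_∞)`,
the Pontryagin-dual hypothesis structure `SignedSelmerDualData W κ γ ε`) and of the tree's
`IwasawaCoinvariantsRankProofs.lean` (Greenberg's "easy half of control",
`WeierstrassCurve.mordellWeilRank_le_coinvariantsRank` for the classical `SelmerDualData`).
Everything here is PROVED; no definition of mathematical content and no named fact is introduced
(net debt 0). HONEST FRAMING (cell `b2b-bsdres`, harvest seat 2, gen 12): nothing about any curve is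
asserted, nothing is booked, no class label moves (X6 / X7 stay CONSTRUCTION-SHAPED).

## What is proved, and why

The supersingular prover files of the cell (`Summits/…/Supersingular/SignedSqueeze.lean`, p208039,
and `SignedSqueezeX7.lean`) consume, on the sign-agnostic datum `SignedDatum W p = (ξ, L, c)`, the
binder `SignedDatum.OrderOfVanishing := T^{rank E(ℚ)} ∣ ξ`, displayed there as "(C) control, read as
an order of vanishing" (intended sources: Kobayashi 2003 Thm. 9.3 / Sprung 2024 Lemma 5.6, the small
control theorem `X^•/TX^• ↠ X^•_0` with finite kernel). For the divisibility `T^{rank} ∣ ξ^ε` the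
control theorem is NOT needed: exactly as for the classical Selmer group (Greenberg, LNM 1716, §1
p. 65 with §3 Lemma 3.1; tree theorem `mordellWeilRank_le_coinvariantsRank`), the `p^∞` Kummer map
followed by restriction, `E(K) ⊗ ℚ_p/ℤ_p → Sel_{p^∞}(E/K) → Sel_{p^∞}(E/K_∞)^Γ`, has finite kernel
and LANDS IN `Sel^ε(E/K_∞)` — because at the bottom layer `Sel^ε(E/K_0) = Sel_{p^∞}(E/K_0)`
(Kobayashi's condition "`Tr_{n/m+1} P ∈ E(K_m·K_v)` for `m < n`" is empty for `n = 0`: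
`E^±(F_{0,p}) = E(ℚ_p)`, tree `signedLocalPointsOfEmb_zero`) — so that
`rank E(K) ≤ corank_{ℤ_p} Sel^ε(E/K_∞)^Γ = rank_{ℤ_p} X^ε/TX^ε ≤ ord_{T=0} ξ^ε` for `X^ε` finitely
generated `Λ`-torsion (structure theory, tree `IwasawaAlgebra.coinvariantsRank_le_order_of_mem_charIdeal`).
This holds for EVERY number field `K`, EVERY `ℤ_p`-extension `κ` with topological generator `γ`,
EVERY sign `ε` and EVERY datum `D : SignedSelmerDualData W κ γ ε` — no reduction hypothesis at `p`
and no `a_p = 0` is used (those enter only Kobayashi's Thm. 1.2, the torsion-ness of `X^ε`, which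
is a displayed hypothesis here and a named fact in `SignedSelmerTorsion.lean`).

## Contents

* §1 `localKerOverOfEmb_le_localKummerOverOfEmb_fixedPoints` — for a compact `H ≤ Γ_K` the classical
  local condition (the class dies in `H¹(H_E, E(K̄_E))`) IS the Kummer condition cut out by ALL of
  `E(L_w) = E(K̄_E)^{H_E}` (`localKummerOverOfEmb … (FixedPoints.addSubgroup H_E _)`): a cocycle that
  is the coboundary of `Q ∈ E(K̄_E)` on `H_E` is killed by one power `p^k` (compactness, tree
  `exists_pow_smul_apply_eq_zero`), so `p^k Q` is `H_E`-fixed — the Kummer cocycle of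
  `p^k Q ⊗ p^{-k}`; with the converse `localKummerOverOfEmb_le_localKerOverOfEmb` of `SignedSelmer.lean`
  this is an equality (`localKummerOverOfEmb_fixedPoints_eq`).
* §2 `selmerLayer_zero_le_signedSelmerLayer`, `signedSelmerLayer_zero_eq` —
  **`Sel^ε(E/K_0) = Sel_{p^∞}(E/K_0)`** (Def. 1.1 at `n = 0`).
* §3 `resInfty_kummerMapPInfty_mem_signedSelmerInfty`, `exists_pow_smul_ker_kummerToSignedInfty` —
  the map `θ^ε : E(K) ⊗ ℚ_p/ℤ_p → Sel^ε(E/K_∞)` (`res ∘ κ_∞` lands in `Sel^ε_∞`) and the uniform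
  exponent killing its (finite) kernel (Greenberg's Lemma 3.1, tree).
* §4 `SignedSelmerDualData.mordellWeilRank_le_coinvariantsRank(_of)` —
  **`rank E(K) ≤ rank_{ℤ_p} X^ε/TX^ε`** for `X^ε` finitely generated over `Λ` (the proof of the tree's
  `mordellWeilRank_le_coinvariantsRank`, verbatim on the signed datum: Pontryagin evaluation of `r`
  characters at the `γ`-fixed `p^N`-torsion classes `θ^ε(P_i ⊗ [p^{-N}])`).
* §5 `SignedSelmerDualData.mordellWeilRank_le_order_of_mem_charIdeal`,
  `….X_pow_mordellWeilRank_dvd_of_mem_charIdeal`, `….X_pow_mordellWeilRank_dvd_of_charIdeal_eq_span` —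
  **`rank E(K) ≤ ord_{T=0} f` and `T^{rank E(K)} ∣ f` for every `f ∈ Char(X^ε)`**, `X^ε` finitely
  generated `Λ`-torsion; for `K = ℚ` and a characteristic power series `ξ^ε` this is the body of the
  cell's binder `SignedDatum.OrderOfVanishing` with `xi := ξ^ε`.

References: S. Kobayashi, Invent. Math. 152 (2003), Def. 1.1 (p. 2; `E^±(F_{0,p}) = E(ℚ_p)`),
Thm. 1.2 [Kobayashi2003]; R. Greenberg, *Iwasawa theory for elliptic curves*, LNM 1716 (1999), §1
pp. 63, 65 and §3 Lemma 3.1 (p. 86) [GreenbergLNM1716]; J. Balakrishnan, J. S. Müller, W. Stein,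
Math. Comp. 85 (2016), Thm. 1.7 (`ord_{T=0} f ≥ rank`, the ordinary analogue)
[BalakrishnanMullerStein2015]; F. Sprung, Adv. Math. 449 (2024) 109741, Lemma 5.6 (the control
theorem this file does NOT need) [Sprung2024].
-/

noncomputable section

open CategoryTheory Literature.NumberTheory.EllipticCurves Literature.NumberTheory.GaloisRepresentations
  Literature.NumberTheory.EllipticCurves.ResKernel Literature.NumberTheory.EllipticCurves.IwasawaAlgebra
  WeierstrassCurve ZpExtension

open scoped Classical AddSubgroup TensorProduct

universe u

namespace Literature.NumberTheory.EllipticCurves.Kobayashi2003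

/-! ## §1. The classical local condition is the Kummer condition cut out by all local points -/

section LocalKummer

variable {K : Type u} [Field K] (W : WeierstrassCurve K) (p : ℕ)
  (H : Subgroup (Field.absoluteGaloisGroup K))
variable {E : Type u} [Field E] [Algebra K E] (ι : AlgebraicClosure K →ₐ[K] AlgebraicClosure E)

/-- **Kernel condition ⇒ Kummer condition (full local points).** For `H ≤ Γ_K` compact (e.g. open,
or closed) with fixed field `L` and a `K`-embedding `ι : K̄ → K̄_E` (the place `w ∣ v` of `L`): a
class `c ∈ H¹(H, E[p^∞])` dying in `H¹(Gal(K̄_E/L_w), E(K̄_E))` lies in the Kummer image of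
`E(L_w) ⊗ ℚ_p/ℤ_p`, `E(L_w) = E(K̄_E)^{Gal(K̄_E/L_w)}`: if `c = [φ]` with `ι φ(τ) = τQ - Q` on `H_E`
then, `φ` being killed by one `p^k` (finite image: `H` compact, `E[p^∞]` discrete), `p^k Q` is fixed
by `H_E` and `c` is the Kummer class of `p^k Q ⊗ p^{-k}`. ("We regard `E(K_{n,v}) ⊗ ℚ_p/ℤ_p` as a
subgroup of `H¹(K_{n,v}, E[p^∞])` by the Kummer map", Kobayashi p. 4; Greenberg 1999 §2.)
[cite: Kobayashi2003, Def. 1.1 and §2 p. 4] [cite: GreenbergLNM1716, §2] -/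
theorem localKerOverOfEmb_le_localKummerOverOfEmb_fixedPoints [CompactSpace H] :
    W.localKerOverOfEmb p H ι ≤
      localKummerOverOfEmb W p H ι
        (FixedPoints.addSubgroup (localSubgroupOfEmb H ι) (localPoints W E)) := by
  intro c hc
  obtain ⟨φ, rfl⟩ := oneCocycleClass_surjective (discreteTopRep H (W.geomPrimaryTorsion p)) c
  have h0 : W.localResOverOfEmb p H ι
      (oneCocycleClass (discreteTopRep H (W.geomPrimaryTorsion p)) φ) = 0 := hc
  change (ContinuousCohomology.map (resGalSubgroupOfEmb H ι) (resHomOfEquivariant _ _ _) 1).hom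
      (oneCocycleClass (discreteTopRep H (W.geomPrimaryTorsion p)) φ) = 0 at h0
  rw [map_oneCocycleClass, oneCocycleClass_eq_zero_iff] at h0
  obtain ⟨Q, hQ⟩ := h0
  have hQ' : ∀ τ : localSubgroupOfEmb H ι,
      pointsMapOfEmb W ι ((φ.1 (resGalSubgroupOfEmb H ι τ) : W.geomPrimaryTorsion p) :
          W.geomPoints) = (τ : Field.absoluteGaloisGroup E) • Q - Q := fun τ => hQ τ
  -- one power of `p` kills the cocycle
  have hM : ∀ g : H, ∃ k : ℕ, p ^ k • φ.1 g = 0 := fun g => by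
    obtain ⟨k, hk⟩ := AddCommGroup.mem_primaryComponent.mp (φ.1 g).2
    exact ⟨k, Subtype.ext (by rw [AddSubmonoidClass.coe_nsmul, hk, ZeroMemClass.coe_zero])⟩
  obtain ⟨k, hk⟩ := exists_pow_smul_apply_eq_zero φ.1 hM
  refine ⟨φ, Q, k, rfl, ?_, hQ'⟩
  -- `p^k Q` is fixed by `H_E`
  rw [FixedPoints.mem_addSubgroup]
  intro τ
  have h2 : (p ^ k) • ((τ : Field.absoluteGaloisGroup E) • Q - Q) = 0 := by
    rw [← hQ' τ, ← map_nsmul, ← AddSubmonoidClass.coe_nsmul, hk, ZeroMemClass.coe_zero, map_zero]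
  rw [smul_sub, sub_eq_zero] at h2
  change (τ : Field.absoluteGaloisGroup E) • ((p ^ k) • Q) = (p ^ k) • Q
  have h3 : (τ : Field.absoluteGaloisGroup E) • ((p ^ k) • Q) =
      (p ^ k) • ((τ : Field.absoluteGaloisGroup E) • Q) :=
    map_nsmul (DistribSMul.toAddMonoidHom (localPoints W E) (τ : Field.absoluteGaloisGroup E))
      (p ^ k) Q
  rw [h3, h2]

/-- **The classical local condition equals the Kummer condition cut out by all of `E(L_w)`** (for
compact `H`): `ker(H¹(H, E[p^∞]) → H¹(H_E, E(K̄_E))) = im(E(L_w) ⊗ ℚ_p/ℤ_p)` inside `H¹(H, E[p^∞])`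
— the local Kummer sequence. [cite: Kobayashi2003, Def. 1.1 and §2 p. 4] [cite: GreenbergLNM1716, §2] -/
theorem localKummerOverOfEmb_fixedPoints_eq [CompactSpace H] :
    localKummerOverOfEmb W p H ι
        (FixedPoints.addSubgroup (localSubgroupOfEmb H ι) (localPoints W E)) =
      W.localKerOverOfEmb p H ι :=
  le_antisymm (localKummerOverOfEmb_le_localKerOverOfEmb _)
    (localKerOverOfEmb_le_localKummerOverOfEmb_fixedPoints W p H ι)

end LocalKummer

/-! ## §2. The bottom layer: `Sel^ε(E/K_0) = Sel_{p^∞}(E/K_0)` -/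

section LayerZero

variable {K : Type u} [Field K] [NumberField K] (W : WeierstrassCurve K) {p : ℕ} [Fact p.Prime]
  (κ : ZpExtension K p)

omit [NumberField K] in
/-- The layer subgroups `Gal(K̄/K_n)` are compact (open, hence closed, in the compact `Γ_K`).
[folklore] -/
private theorem compactSpace_layerSubgroup [CharZero K] (n : ℕ) :
    CompactSpace (κ.layerSubgroup n) := by
  haveI : CompactSpace (Field.absoluteGaloisGroup K) := compactSpace_absoluteGaloisGroup K
  exact isCompact_iff_compactSpace.mp
    (Subgroup.isClosed_of_isOpen _ (κ.isOpen_layerSubgroup n)).isCompact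

/-- **`Sel_{p^∞}(E/K_0) ≤ Sel^ε(E/K_0)`**: at the bottom layer the signed condition at `v ∣ p` is the
Kummer condition cut out by all of `E(K_0·K_v)` (`signedLocalPointsOfEmb_zero`: "for `m` with
`0 ≤ m < 0`" is empty — Kobayashi's `E^±(F_{0,p}) = E(ℚ_p)`), which is the classical local condition
(§1). [cite: Kobayashi2003, Def. 1.1 (p. 2)] -/
theorem selmerLayer_zero_le_signedSelmerLayer (ε : ℤˣ) :
    W.selmerLayer κ 0 ≤ signedSelmerLayer W κ ε 0 := by
  intro c hc
  rw [mem_signedSelmerLayer_iff]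
  refine ⟨hc, fun v _ σ => ?_⟩
  have h1 : W.conjH1 p (κ.layerSubgroup 0) σ c ∈
      W.localKerOver p (κ.layerSubgroup 0) (v.adicCompletion K) :=
    ((W.mem_selmerGroupOver_iff p (κ.layerSubgroup 0) c).mp hc).1 v σ
  rw [localKerOver_eq_ofEmb] at h1
  haveI : CompactSpace (κ.layerSubgroup 0) := compactSpace_layerSubgroup κ 0
  have h2 := localKerOverOfEmb_le_localKummerOverOfEmb_fixedPoints W p (κ.layerSubgroup 0)
    (closureEmb (K := K) (v.adicCompletion K)) h1
  rw [signedLocalPoints, signedLocalPointsOfEmb_zero]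
  exact h2

/-- **`Sel^ε(E/K_0) = Sel_{p^∞}(E/K_0)`** (both signs). [cite: Kobayashi2003, Def. 1.1 (p. 2)] -/
theorem signedSelmerLayer_zero_eq (ε : ℤˣ) : signedSelmerLayer W κ ε 0 = W.selmerLayer κ 0 :=
  le_antisymm (signedSelmerLayer_le_selmerLayer W κ ε 0) (selmerLayer_zero_le_signedSelmerLayer W κ ε)

end LayerZero

/-! ## §3. `θ^ε : E(K) ⊗ ℚ_p/ℤ_p → Sel^ε(E/K_∞)` -/

section Theta

variable {K : Type u} [Field K] [NumberField K] (W : WeierstrassCurve K) [W.IsElliptic] {p : ℕ}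
  [Fact p.Prime] (κ : ZpExtension K p) (ε : ℤˣ) (hdiv : W.zsmul_geomPoints_surjective)

/-- **The `p^∞` Kummer map followed by restriction to `K_∞` lands in `Sel^ε(E/K_∞)`**: the image
of `Sel_{p^∞}(E/K)` in `H¹(K_0, E[p^∞])` lies in `Sel(E/K_0) = Sel^ε(E/K_0)` (§2), whose image under
`H¹(K_0, ·) → H¹(K_∞, ·)` is in `Sel^ε(E/K_∞) = ⋃_n im Sel^ε(E/K_n)` by definition; and
`res_{K_∞/K} = res_{K_∞/K_0} ∘ res_{K_0/K}` (`resOfLe_comp`). Greenberg 1999 §2 p. 72 ("Obviously,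
`Im(κ) ⊆ Sel_E(M)_p`") with Kobayashi's Def. 1.1 at `n = 0`. [cite: Kobayashi2003, Def. 1.1 (p. 2)]
[cite: GreenbergLNM1716, §2 p. 72] -/
theorem resInfty_kummerMapPInfty_mem_signedSelmerInfty (t : W.toAffine.Point ⊗[ℤ] PruferQuot p) :
    W.resInfty p κ (W.kummerMapPInfty p hdiv t) ∈ signedSelmerInfty W κ ε := by
  set c := W.kummerMapPInfty p hdiv t with hcdef
  have hsel : c ∈ W.selmerGroupPInfty p := by
    refine W.ker_primaryH1ToH1_le_selmerGroupPInfty p ?_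
    rw [← W.range_kummerMapPInfty p hdiv]
    exact ⟨t, rfl⟩
  have htop := W.resSubgroup_top_mem_selmerGroupOver hsel
  have h0 : W.resOfLe p (le_top : κ.layerSubgroup 0 ≤ ⊤) (resSubgroup ⊤ (geomPrimaryTorsion W p) c) ∈
      W.selmerLayer κ 0 :=
    W.resOfLe_mem_selmerGroupOver p le_top htop
  have h0' := selmerLayer_zero_le_signedSelmerLayer W κ ε h0
  have heq : W.resInfty p κ c = W.layerToInfty κ 0
      (W.resOfLe p (le_top : κ.layerSubgroup 0 ≤ ⊤) (resSubgroup ⊤ (geomPrimaryTorsion W p) c)) := by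
    rw [resInfty_eq_comp, AddMonoidHom.comp_apply, layerToInfty, ← AddMonoidHom.comp_apply
      (W.resOfLe p (κ.kerSubgroup_le_layerSubgroup 0)), W.resOfLe_comp_holds p]
  rw [heq]
  exact map_layerToInfty_signedSelmerLayer_le W κ ε 0 ⟨_, h0', rfl⟩

variable {κ}

/-- **`θ^ε : E(K) ⊗ ℚ_p/ℤ_p → Sel^ε(E/K_∞)`** — the `p^∞` Kummer map followed by restriction to
`K_∞`, corestricted to the signed Selmer group (`AddMonoidHom.codRestrict` of
`resInfty ∘ kummerMapPInfty`, the underlying map of the tree's `kummerToInfty`) — **has kernel killed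
by one power `p^a`**: the kernel is that of `kummerToInfty`, which is finite (Kummer map injective,
`ker res` finite — Greenberg's Lemma 3.1; tree `exists_pow_smul_ker_kummerToInfty`).
[cite: GreenbergLNM1716, §3 Lemma 3.1] -/
theorem exists_pow_smul_ker_kummerToSignedInfty {γ : Field.absoluteGaloisGroup K}
    (hγ : κ.IsTopGenerator γ) :
    ∃ a : ℕ, ∀ t ∈ (((W.resInfty p κ).comp (W.kummerMapPInfty p hdiv)).codRestrict
      (signedSelmerInfty W κ ε) (resInfty_kummerMapPInfty_mem_signedSelmerInfty W κ ε hdiv)).ker,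
      p ^ a • t = 0 := by
  obtain ⟨a, ha⟩ := W.exists_pow_smul_ker_kummerToInfty hdiv hγ (p := p)
  refine ⟨a, fun t ht => ha t ?_⟩
  rw [AddMonoidHom.mem_ker] at ht ⊢
  apply Subtype.ext
  have h := congrArg (fun s : signedSelmerInfty W κ ε => (s : W.subgroupH1 p κ.kerSubgroup)) ht
  rw [AddMonoidHom.codRestrict_apply, ZeroMemClass.coe_zero] at h
  rw [coe_kummerToInfty, ZeroMemClass.coe_zero]
  exact h

end Theta

/-! ## §4. `rank E(K) ≤ rank_{ℤ_p} X^ε/TX^ε` -/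

namespace SignedSelmerDualData

variable {K : Type u} [Field K] [NumberField K] {W : WeierstrassCurve K} [W.IsElliptic] {p : ℕ}
  [Fact p.Prime] {κ : ZpExtension K p} {γ : Field.absoluteGaloisGroup K} {ε : ℤˣ}

/-- **`rank E(K) ≤ rank_{ℤ_p} X^ε(E/K_∞)_Γ`**, with the divisibility of `E(K̄)` as hypothesis `hdiv`.
The proof of the tree's `WeierstrassCurve.mordellWeilRank_le_coinvariantsRank_of`, verbatim on the
signed datum: with `P_1,…,P_r ∈ E(K)` independent and integral functionals `λ_k` (`λ_k(P_i) =
N₀δ_{ki}`), the characters `p^a χ_k`, `χ_k(P ⊗ t) = c₀(λ_k(P)t)`, of `E(K) ⊗ ℚ_p/ℤ_p` descend along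
`θ^ε` (whose kernel `p^a` kills), extend to `Sel^ε_∞` (injectivity of `ℚ/ℤ`) and give `x_k ∈ X^ε`
with `ℤ_p`-independent images in `X^ε/TX^ε` (evaluate a relation at the `γ`-fixed `p^N`-torsion
classes `θ^ε(P_i ⊗ [p^{-N}])`). Greenberg 1999 §1 pp. 63, 65 with §3 Lemma 3.1.
[cite: GreenbergLNM1716, §1 pp. 63, 65 and §3 Lemma 3.1] [cite: Kobayashi2003, Def. 1.1 (p. 2)] -/
theorem mordellWeilRank_le_coinvariantsRank_of (hdiv : W.zsmul_geomPoints_surjective)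
    (hγ : κ.IsTopGenerator γ) (D : SignedSelmerDualData W κ γ ε)
    [Module.Finite (IwasawaAlgebra p) D.X] :
    W.mordellWeilRank ≤ coinvariantsRank p D.X := by
  have hp := (Fact.out : p.Prime)
  obtain ⟨P, lam, N₀, hN₀, hlam⟩ := W.exists_points_functionals
  obtain ⟨c₀, hc₀⟩ := exists_character_prufGen p
  let c₀' : PruferQuot p →+ AddCircle (1 : ℚ) := c₀
  have hc₀' : ∀ t, c₀' t = c₀ t := fun _ ↦ rfl
  obtain ⟨a, ha⟩ := exists_pow_smul_ker_kummerToSignedInfty W ε hdiv hγ (p := p)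
  -- `θ^ε = res ∘ κ_∞`, corestricted to `Sel^ε_∞`
  let θ : W.toAffine.Point ⊗[ℤ] PruferQuot p →+ signedSelmerInfty W κ ε :=
    ((W.resInfty p κ).comp (W.kummerMapPInfty p hdiv)).codRestrict
      (signedSelmerInfty W κ ε) (resInfty_kummerMapPInfty_mem_signedSelmerInfty W κ ε hdiv)
  -- the characters `χ_k` of `E(K) ⊗ ℚ_p/ℤ_p`, multiplied by `p^a`
  let χ : Fin (Module.finrank ℤ W.toAffine.Point) →
      (W.toAffine.Point ⊗[ℤ] PruferQuot p →+ AddCircle (1 : ℚ)) :=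
    fun k ↦ (c₀'.toIntLinearMap ∘ₗ (TensorProduct.lid ℤ (PruferQuot p)).toLinearMap ∘ₗ
      ((lam k).rTensor (PruferQuot p))).toAddMonoidHom
  have hχ : ∀ k Q (t : PruferQuot p), χ k (Q ⊗ₜ t) = c₀' (lam k Q • t) := fun k Q t ↦ by
    simp [χ]
  let χ' : Fin (Module.finrank ℤ W.toAffine.Point) →
      (W.toAffine.Point ⊗[ℤ] PruferQuot p →+ AddCircle (1 : ℚ)) :=
    fun k ↦ (nsmulAddMonoidHom (p ^ a)).comp (χ k)
  have hχ' : ∀ k t, χ' k t = p ^ a • χ k t := fun k t ↦ rfl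
  have hker : ∀ k, θ.rangeRestrict.ker ≤ (χ' k).ker := by
    intro k t ht
    rw [AddMonoidHom.mem_ker] at ht ⊢
    have ht' : t ∈ θ.ker := by
      rw [AddMonoidHom.mem_ker]
      exact congrArg (fun z : θ.range ↦ (z : signedSelmerInfty W κ ε)) ht
    rw [hχ', ← map_nsmul, ha t ht', map_zero]
  -- descend to `range θ`
  have hsurj : Function.Surjective θ.rangeRestrict := AddMonoidHom.rangeRestrict_surjective θ
  let ψ : Fin (Module.finrank ℤ W.toAffine.Point) → (θ.range →+ AddCircle (1 : ℚ)) := fun k ↦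
    θ.rangeRestrict.liftOfSurjective hsurj ⟨χ' k, hker k⟩
  have hψ : ∀ k t, ψ k (θ.rangeRestrict t) = χ' k t := fun k t ↦
    AddMonoidHom.liftOfRightInverse_comp_apply _ _ _ _ t
  -- extend to characters of `Sel^ε_∞` (injectivity of `ℚ/ℤ`)
  have hext : ∀ k, ∃ xt : signedSelmerInfty W κ ε →+ AddCircle (1 : ℚ),
      ∀ g : θ.range, xt g = ψ k g := by
    intro k
    obtain ⟨xt, hxt⟩ := CharacterModule.dual_surjective_of_injective
      (θ.range.subtype.toIntLinearMap) (fun a b h ↦ Subtype.ext h) (ψ k)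
    refine ⟨xt, fun g ↦ ?_⟩
    have := DFunLike.congr_fun hxt g
    rw [CharacterModule.dual_apply] at this
    exact this
  choose xt hxt using hext
  -- lift to `X` along `toDual`
  have hX : ∀ k, ∃ x : D.X, D.toDual x = xt k := fun k ↦ D.bijective.2 (xt k)
  choose x hx using hX
  -- values of the characters on the test elements `θ(P_i ⊗ [p^{-N}])`
  have hval : ∀ k i N, xt k (θ (P i ⊗ₜ[ℤ] prufGen p N)) =
      (p ^ a * if k = i then N₀ else 0) • c₀' (prufGen p N) := by
    intro k i N
    have e1 : θ (P i ⊗ₜ[ℤ] prufGen p N) =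
        ((θ.rangeRestrict (P i ⊗ₜ[ℤ] prufGen p N) : θ.range) : signedSelmerInfty W κ ε) := rfl
    rw [e1, hxt k, hψ k, hχ', hχ, hlam k i]
    split_ifs with hki
    · rw [map_zsmul, natCast_zsmul, smul_smul]
    · simp
  -- the candidate independent family in `X/TX`
  letI : Module ℤ_[p] (coinvariants p D.X) :=
    Module.compHom _ (algebraMap ℤ_[p] (IwasawaAlgebra p))
  haveI : Module.Finite ℤ_[p] (coinvariants p D.X) := finite_int_coinvariants p D.X
  let y : Fin (Module.finrank ℤ W.toAffine.Point) → coinvariants p D.X :=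
    fun k ↦ Submodule.Quotient.mk (x k)
  have hli : LinearIndependent ℤ_[p] y := by
    rw [Fintype.linearIndependent_iff]
    intro g hg i
    -- `∑ g k • y k = mk (∑ C (g k) • x k)`
    have hsum : (∑ k, g k • y k) = Submodule.Quotient.mk
        (∑ k, (PowerSeries.C (g k) : IwasawaAlgebra p) • x k) := by
      rw [← Submodule.mkQ_apply, map_sum]
      refine Finset.sum_congr rfl fun k _ ↦ ?_
      rw [map_smul, Submodule.mkQ_apply]
      change (algebraMap ℤ_[p] (IwasawaAlgebra p) (g k)) • y k = _
      rw [PowerSeries.algebraMap_eq]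
    rw [hsum, Submodule.Quotient.mk_eq_zero, Submodule.ideal_span_singleton_smul,
      Submodule.mem_smul_pointwise_iff_exists] at hg
    obtain ⟨z, -, hz⟩ := hg
    -- evaluate the characters at the test elements
    have hdvd : ∀ N, p ^ N ∣ (PadicInt.toZModPow N (g i)).val * (p ^ a * N₀) := by
      intro N
      have hsN : p ^ N • θ (P i ⊗ₜ[ℤ] prufGen p N) = 0 := by
        rw [← map_nsmul, ← natCast_zsmul, ← TensorProduct.tmul_smul, zsmul_prufGen_self,
          TensorProduct.tmul_zero, map_zero]
      have hconj : (⟨W.conjH1 p κ.kerSubgroup γ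
          (θ (P i ⊗ₜ[ℤ] prufGen p N) : W.subgroupH1 p κ.kerSubgroup),
          D.conj_mem _ (θ (P i ⊗ₜ[ℤ] prufGen p N)).2⟩ : signedSelmerInfty W κ ε) =
            θ (P i ⊗ₜ[ℤ] prufGen p N) :=
        Subtype.ext (W.conjH1_resInfty κ γ _)
      have hC : ∀ (c : ℤ_[p]) (x' : D.X),
          D.toDual (PowerSeries.C c • x') (θ (P i ⊗ₜ[ℤ] prufGen p N)) =
            (PadicInt.toZModPow N c).val • D.toDual x' (θ (P i ⊗ₜ[ℤ] prufGen p N)) :=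
        fun c x' ↦ D.toDual_C_smul c x' _ N hsN
      have h1 := congrArg (fun w ↦ D.toDual w (θ (P i ⊗ₜ[ℤ] prufGen p N))) hz
      beta_reduce at h1
      rw [D.toDual_T_smul, hconj, sub_self, map_sum, AddMonoidHom.finsetSum_apply] at h1
      simp_rw [hC, hx, hval] at h1
      rw [Finset.sum_eq_single i (fun k _ hk ↦ by simp [hk]) (fun h ↦ (h (Finset.mem_univ i)).elim),
        if_pos rfl, smul_smul, eq_comm] at h1
      have h2 := addOrderOf_dvd_iff_nsmul_eq_zero.mpr h1
      rwa [hc₀', hc₀ N] at h2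
    exact padicInt_eq_zero_of_forall_dvd (g i) (mul_ne_zero (pow_ne_zero _ hp.ne_zero) hN₀) hdvd
  -- conclude
  have hcard := hli.fintype_card_le_finrank
  rw [Fintype.card_fin] at hcard
  have e : coinvariantsRank p D.X = Module.finrank ℤ_[p] (coinvariants p D.X) := by
    show Module.finrank ℚ_[p] (ℚ_[p] ⊗[ℤ_[p]] (coinvariants p D.X)) = _
    exact (TensorProduct.isBaseChange ℤ_[p] (coinvariants p D.X) ℚ_[p]).finrank_eq
  rw [e]
  exact hcard

/-- **`rank E(K) ≤ rank_{ℤ_p} X^ε(E/K_∞)_Γ`**, unconditionally (`hdiv` fed with the tree theorem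
`zsmul_geomPoints_surjective_holds`): for an elliptic curve over a number field `K`, ANY
`ℤ_p`-extension `κ` with topological generator `γ`, ANY sign `ε` and ANY Pontryagin-dual datum `D`
of Kobayashi's `Sel^ε(E/K_∞)` with `X^ε = D.X` finitely generated over `Λ`:
`rank E(K) ≤ rank_{ℤ_p} X^ε/TX^ε`. No hypothesis on the reduction of `E` at `p`.
[cite: GreenbergLNM1716, §1 pp. 63, 65 and §3 Lemma 3.1] [cite: Kobayashi2003, Def. 1.1 (p. 2)] -/
theorem mordellWeilRank_le_coinvariantsRank (hγ : κ.IsTopGenerator γ)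
    (D : SignedSelmerDualData W κ γ ε) [Module.Finite (IwasawaAlgebra p) D.X] :
    W.mordellWeilRank ≤ coinvariantsRank p D.X :=
  D.mordellWeilRank_le_coinvariantsRank_of W.zsmul_geomPoints_surjective_holds hγ

/-! ## §5. `T^{rank E(K)} ∣ f` for `f ∈ Char(X^ε)` -/

/-- **`rank E(K) ≤ ord_{T=0} f` for every `f ∈ Char(X^ε(E/K_∞))`**, `X^ε` finitely generated
`Λ`-torsion: `rank E(K) ≤ rank_{ℤ_p} X^ε/TX^ε` (§4) and `rank_{ℤ_p} X/TX ≤ ord_T f`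
(`IwasawaAlgebra.coinvariantsRank_le_order_of_mem_charIdeal`, structure theory). The signed
analogue of the tree's `WeierstrassCurve.mordellWeilRank_le_order_of_mem_charIdeal` (BMS Thm. 1.7
shape). [cite: GreenbergLNM1716, §1 pp. 63, 65 and §3 Lemma 3.1] [cite: BalakrishnanMullerStein2015, Thm. 1.7] -/
theorem mordellWeilRank_le_order_of_mem_charIdeal (hγ : κ.IsTopGenerator γ)
    (D : SignedSelmerDualData W κ γ ε) [Module.Finite (IwasawaAlgebra p) D.X]
    (hX : Module.IsTorsion (IwasawaAlgebra p) D.X) {f : IwasawaAlgebra p} (hf : f ∈ D.charIdeal) :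
    (W.mordellWeilRank : ℕ∞) ≤ f.order := by
  have h0 : (W.mordellWeilRank : ℕ∞) ≤ (coinvariantsRank p D.X : ℕ∞) := by
    exact_mod_cast D.mordellWeilRank_le_coinvariantsRank hγ
  exact h0.trans (coinvariantsRank_le_order_of_mem_charIdeal D.X hX f hf)

/-- **`T^{rank E(K)} ∣ f` for every `f ∈ Char(X^ε(E/K_∞))`** (`X^ε` finitely generated
`Λ`-torsion). [cite: GreenbergLNM1716, §1 pp. 63, 65 and §3 Lemma 3.1] [cite: BalakrishnanMullerStein2015, Thm. 1.7] -/
theorem X_pow_mordellWeilRank_dvd_of_mem_charIdeal (hγ : κ.IsTopGenerator γ)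
    (D : SignedSelmerDualData W κ γ ε) [Module.Finite (IwasawaAlgebra p) D.X]
    (hX : Module.IsTorsion (IwasawaAlgebra p) D.X) {f : IwasawaAlgebra p} (hf : f ∈ D.charIdeal) :
    (PowerSeries.X : IwasawaAlgebra p) ^ W.mordellWeilRank ∣ f := by
  have hle := D.mordellWeilRank_le_order_of_mem_charIdeal hγ hX hf
  exact PowerSeries.X_pow_dvd_iff.mpr fun m hm =>
    PowerSeries.coeff_of_lt_order m (lt_of_lt_of_le (by exact_mod_cast hm) hle)

/-- **`T^{rank E(K)} ∣ ξ^ε` for a characteristic power series `ξ^ε`** (`Char(X^ε) = (ξ^ε)`, `X^ε`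
finitely generated `Λ`-torsion) — for `K = ℚ` the body of the cell's binder
`Summit.….Supersingular.SignedDatum.OrderOfVanishing` with `xi := ξ^ε`, obtained here WITHOUT a
control theorem. [cite: GreenbergLNM1716, §1 pp. 63, 65 and §3 Lemma 3.1] [cite: Kobayashi2003, Def. 1.1 and Thm. 1.2 (p. 2)] -/
theorem X_pow_mordellWeilRank_dvd_of_charIdeal_eq_span (hγ : κ.IsTopGenerator γ)
    (D : SignedSelmerDualData W κ γ ε) [Module.Finite (IwasawaAlgebra p) D.X]
    (hX : Module.IsTorsion (IwasawaAlgebra p) D.X) {ξ : IwasawaAlgebra p}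
    (hξ : D.charIdeal = Ideal.span {ξ}) :
    (PowerSeries.X : IwasawaAlgebra p) ^ W.mordellWeilRank ∣ ξ :=
  D.X_pow_mordellWeilRank_dvd_of_mem_charIdeal hγ hX (hξ ▸ Ideal.mem_span_singleton_self ξ)

end SignedSelmerDualData

end Literature.NumberTheory.EllipticCurves.Kobayashi2003

end
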